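import Summits.ResolutionOfSingularities.ResolutionOfSingularities.Theorems.FrobeniusLadderFInjectiveMacaulayficationClauseOfPderivNotMem
import Mathlib.Algebra.MvPolynomial.PDeriv
import Mathlib.Algebra.CharP.Algebra
import Mathlib.Tactic.LinearCombination
import HarnessLib

/-!
# RGDD-L row F008 at `p = 5`, diagonalised form `g`: the off-axis clause `hoff` — `V(g)` is REGULAR off the `t`-axis `L`
# (crux `FInjectiveMacaulayfication` stmt-ResolutionOfSingularities-15315, chain w45a; first relative-GDD Lean instance, res-L1-w45a-stub-1 g6
# lead; res-L1-w45a-plan-1 R15.48 (4) + stub-1 CONSENT-WITH-SPLIT 19:14:38Z «stub-2 = `hoff` ONLY, theorem `g_offL_clause_char5`»;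
# brief `L/res-L1-w45a-stub-1/g6-F008-hoff-brief-for-stub-2.md`; machine facts res-L1-w45a-tri-1 j287800/j287905, stub-1 j287843/j287923;
# seat res-L1-w45a-stub-2)

[OURS · L1 W4.5a] Support file (`--supports stmt-ResolutionOfSingularities-15315 --as helper`); NOT a statement of any manuscript; no named
fact; no definitions; AI-written (AI review is weaker than expert review).

THE POLYNOMIAL (`x,y,z,w,t = X 0,…,X 4`, `φ = y² + x³`, any field `k` of characteristic `5`):

  `g = z² + t⁴w⁶ + φ³ + t·x³y·w³ + x¹¹ + w⁷`  (`= σ(F008)`, `σ : z ↦ z + 2t²w³`, res-L1-w45a-stub-1).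

THE THEOREM `g_offL_clause_char5` = the hypothesis `hoff` of `FilteredConeFiModelRel.filteredConeFiModelRel_affineBlowup` for `n = 5`,
`J = {0,1,2,3}`, `p = 5`: at every maximal ideal `Q` of `k[X]/(g)` with some `x̄ⱼ ∉ Q`, `j ≤ 3` (i.e. off `L = V(x,y,z,w)`), the local ring
satisfies the Cohen–Macaulay + Frobenius-closed clause. PROOF: `V(g)` is REGULAR off `L` (machine fact: the only minimal prime of the
Jacobian ideal `(g, ∇g)` over `GF(5)` is `(x,y,z,w)`), so at such `Q` some partial `∂ᵢ g ∉ P := Q ∩ k[X]` and `ClauseOfPderivNotMem`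
concludes. The containment «all five partials in a prime `P ∌` some of `x,y,z,w` is impossible» has NO small Nullstellensatz certificate
(cofactors of thousands of terms), so it is proved as a CHAIN IN THE RESIDUE DOMAIN `k[X]/P` (characteristic `5`): `z = 0` (`∂_z = 2z`);
if `w = 0`: `y ≠ 0` forces `φ = 0`, `x¹¹ = 0`, `y = 0`; `y = 0`, `x ≠ 0` forces `x⁸(11x²+9) = 0 = x⁹(x²+1)`, i.e. `2 = 0`; if `w ≠ 0`:
the thirteen-step chain S1–S13 of the brief (`A = 4w³t³ + x³y = 0`, `B`, `t⁴ = 2w`, `t, x, y ≠ 0`, `E1 … E12`, ending with `x = 2` against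
`x² = 3`), every step ONE explicit polynomial identity closed by `linear_combination` (multipliers and the multiple of `5` machine-derived,
kit jobs j288102, j288115 of this seat). [folklore] [cite: Matsumura1987, Thm. 30.4 (ii)]
-/

-- single-problem summit: the doubled namespace component is forced
set_option linter.dupNamespace false

noncomputable section

namespace Summit.ResolutionOfSingularities.ResolutionOfSingularities.Theorems.FInjectiveMacaulayfication.RelGddF008Regular

open MvPolynomial
open Summit.ResolutionOfSingularities.ResolutionOfSingularities.Theorems.FInjectiveMacaulayfication

/-- **THE RESIDUE-DOMAIN CHAIN.** In a domain `R` of characteristic `5`, the five equations `∇g = 0` together with `g = 0` force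
`x = y = z = w = 0`. (Pure commutative algebra; every step is an explicit identity.) [folklore] -/
theorem eq_zero_of_jacobian {R : Type} [CommRing R] [IsDomain R] (h5 : (5 : R) = 0) (x y z w t : R)
    (eg : z ^ 2 + t ^ 4 * w ^ 6 + (y ^ 2 + x ^ 3) ^ 3 + t * x ^ 3 * y * w ^ 3 + x ^ 11 + w ^ 7 = 0)
    (e0 : 9 * x ^ 2 * (y ^ 2 + x ^ 3) ^ 2 + 3 * t * x ^ 2 * y * w ^ 3 + 11 * x ^ 10 = 0)
    (e1 : 6 * y * (y ^ 2 + x ^ 3) ^ 2 + t * x ^ 3 * w ^ 3 = 0)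
    (e2 : 2 * z = 0)
    (e3 : 6 * t ^ 4 * w ^ 5 + 3 * t * x ^ 3 * y * w ^ 2 + 7 * w ^ 6 = 0)
    (e4 : 4 * t ^ 3 * w ^ 6 + x ^ 3 * y * w ^ 3 = 0) :
    x = 0 ∧ y = 0 ∧ z = 0 ∧ w = 0 := by
  have h23 : (2 : R) * 3 = 1 := by linear_combination h5
  have hz : z = 0 := by linear_combination 3 * e2 - z * h5
  by_cases hw : w = 0
  · /- CASE `w = 0` -/
    have f0 : 9 * x ^ 2 * (y ^ 2 + x ^ 3) ^ 2 + 11 * x ^ 10 = 0 := by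
      linear_combination e0 - 3 * t * x ^ 2 * y * w ^ 2 * hw
    have f1 : 6 * y * (y ^ 2 + x ^ 3) ^ 2 = 0 := by linear_combination e1 - t * x ^ 3 * w ^ 2 * hw
    have fg : (y ^ 2 + x ^ 3) ^ 3 + x ^ 11 = 0 := by
      linear_combination eg - z * hz - (t ^ 4 * w ^ 5 + t * x ^ 3 * y * w ^ 2 + w ^ 6) * hw
    by_cases hy : y = 0
    · by_cases hx : x = 0
      · exact ⟨hx, hy, hz, hw⟩
      · exfalso
        have h1 : x ^ 8 * (11 * x ^ 2 + 9) = 0 := by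
          linear_combination f0 - 9 * x ^ 2 * ((y ^ 2 + x ^ 3) + x ^ 3) * y * hy
        have h2 : x ^ 9 * (x ^ 2 + 1) = 0 := by
          linear_combination fg - ((y ^ 2 + x ^ 3) ^ 2 + (y ^ 2 + x ^ 3) * x ^ 3 + x ^ 6) * y * hy
        have h1' : 11 * x ^ 2 + 9 = 0 := (mul_eq_zero.mp h1).resolve_left (pow_ne_zero 8 hx)
        have h2' : x ^ 2 + 1 = 0 := (mul_eq_zero.mp h2).resolve_left (pow_ne_zero 9 hx)
        have h20 : (2 : R) = 0 := by linear_combination -h1' + 11 * h2'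
        have : (1 : R) = 0 := by linear_combination -h23 + 3 * h20
        exact one_ne_zero this
    · exfalso
      have hyφ : y * (y ^ 2 + x ^ 3) ^ 2 = 0 := by linear_combination f1 - y * (y ^ 2 + x ^ 3) ^ 2 * h5
      have hφ2 : (y ^ 2 + x ^ 3) ^ 2 = 0 := (mul_eq_zero.mp hyφ).resolve_left hy
      have hφ : y ^ 2 + x ^ 3 = 0 := pow_eq_zero_iff (two_ne_zero) |>.mp hφ2
      have hx11 : x ^ 11 = 0 := by linear_combination fg - (y ^ 2 + x ^ 3) ^ 2 * hφ
      have hx : x = 0 := pow_eq_zero_iff (by norm_num) |>.mp hx11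
      have hy2 : y ^ 2 = 0 := by linear_combination hφ - x ^ 2 * hx
      exact hy (pow_eq_zero_iff two_ne_zero |>.mp hy2)
  · /- CASE `w ≠ 0`: the chain S1–S13 -/
    exfalso
    -- S1, S2: `A = 0`, `B = 0`
    have hA : 4 * w ^ 3 * t ^ 3 + x ^ 3 * y = 0 := by
      have h : w ^ 3 * (4 * w ^ 3 * t ^ 3 + x ^ 3 * y) = 0 := by linear_combination e4
      exact (mul_eq_zero.mp h).resolve_left (pow_ne_zero 3 hw)
    have hB : 6 * w ^ 3 * t ^ 4 + 3 * x ^ 3 * y * t + 7 * w ^ 4 = 0 := by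
      have h : w ^ 2 * (6 * w ^ 3 * t ^ 4 + 3 * x ^ 3 * y * t + 7 * w ^ 4) = 0 := by linear_combination e3
      exact (mul_eq_zero.mp h).resolve_left (pow_ne_zero 2 hw)
    -- S3: `t⁴ = 2w`
    have hD : t ^ 4 - 2 * w = 0 := by
      have h : w ^ 3 * (7 * w - 6 * t ^ 4) = 0 := by linear_combination hB - 3 * t * hA
      have hC : 7 * w - 6 * t ^ 4 = 0 := (mul_eq_zero.mp h).resolve_left (pow_ne_zero 3 hw)
      linear_combination -hC + (w - t ^ 4) * h5
    -- S4: `t, x, y ≠ 0`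
    have ht : t ≠ 0 := by
      intro ht
      apply hw
      have h : 2 * w = 0 := by linear_combination -hD + t ^ 3 * ht
      linear_combination 3 * h - w * h5
    have hwt : w ^ 3 * t ^ 3 ≠ 0 := mul_ne_zero (pow_ne_zero 3 hw) (pow_ne_zero 3 ht)
    have hx : x ≠ 0 := by
      intro hx
      apply hwt
      have h : 4 * (w ^ 3 * t ^ 3) = 0 := by linear_combination hA - x ^ 2 * y * hx
      linear_combination 4 * h - 3 * (w ^ 3 * t ^ 3) * h5
    have hy : y ≠ 0 := by
      intro hy
      apply hwt
      have h : 4 * (w ^ 3 * t ^ 3) = 0 := by linear_combination hA - x ^ 3 * hy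
      linear_combination 4 * h - 3 * (w ^ 3 * t ^ 3) * h5
    -- S5: `E1, E2, E3`
    have eg' : t ^ 4 * w ^ 6 + (y ^ 2 + x ^ 3) ^ 3 + t * x ^ 3 * y * w ^ 3 + x ^ 11 + w ^ 7 = 0 := by
      linear_combination eg - z * hz
    have hE1 : y ^ 2 * (y ^ 2 + x ^ 3) ^ 2 + 2 * w ^ 7 = 0 := by
      linear_combination y * e1 - t * w ^ 3 * hA + 4 * w ^ 6 * hD + (2 * w ^ 7 - x ^ 6 * y ^ 2 - 2 * x ^ 3 * y ^ 4 - y ^ 6) * h5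
    have hE2 : 4 * x ^ 3 * (y ^ 2 + x ^ 3) ^ 2 + x ^ 11 + w ^ 7 = 0 := by
      linear_combination x * e0 - 3 * t * w ^ 3 * hA + 12 * w ^ 6 * hD +
        (5 * w ^ 7 - 2 * x ^ 11 - x ^ 9 - 2 * x ^ 6 * y ^ 2 - x ^ 3 * y ^ 4) * h5
    have hE3 : (y ^ 2 + x ^ 3) ^ 3 + x ^ 11 = 0 := by
      linear_combination eg' - t * w ^ 3 * hA + 3 * w ^ 6 * hD + w ^ 7 * h5
    -- S6: `E4`, `E5`
    have hE4 : (y ^ 2 + x ^ 3) ^ 3 + x ^ 3 * (y ^ 2 + x ^ 3) ^ 2 - 2 * x ^ 11 = 0 := by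
      linear_combination hE1 - 2 * hE2 + (2 * x ^ 9 + 4 * x ^ 6 * y ^ 2 + 2 * x ^ 3 * y ^ 4) * h5
    have hE5 : (y ^ 2 + x ^ 3) ^ 2 - 3 * x ^ 8 = 0 := by
      have h : x ^ 3 * ((y ^ 2 + x ^ 3) ^ 2 - 3 * x ^ 8) = 0 := by linear_combination hE4 - hE3
      exact (mul_eq_zero.mp h).resolve_left (pow_ne_zero 3 hx)
    -- S7: `E6`
    have hE6 : 3 * (y ^ 2 + x ^ 3) + x ^ 3 = 0 := by
      have h : x ^ 8 * (3 * (y ^ 2 + x ^ 3) + x ^ 3) = 0 := by linear_combination hE3 - (y ^ 2 + x ^ 3) * hE5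
      exact (mul_eq_zero.mp h).resolve_left (pow_ne_zero 8 hx)
    -- S8: `E7 : x² = 3`
    have hE7 : x ^ 2 - 3 = 0 := by
      have h : 3 * x ^ 6 * (3 - x ^ 2) = 0 := by
        linear_combination hE5 - 2 * ((y ^ 2 + x ^ 3) + 3 * x ^ 3) * hE6 +
          ((y ^ 2 + x ^ 3) * ((y ^ 2 + x ^ 3) + 3 * x ^ 3) + x ^ 3 * (4 * x ^ 3 + y ^ 2)) * h5
      have h' : x ^ 6 * (3 - x ^ 2) = 0 := by linear_combination 2 * h - x ^ 6 * (3 - x ^ 2) * h5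
      have h'' : 3 - x ^ 2 = 0 := (mul_eq_zero.mp h').resolve_left (pow_ne_zero 6 hx)
      linear_combination -h''
    -- S9: `E8`, `E8'`
    have hE8 : 3 * x ^ 5 * y + w ^ 3 * t = 0 := by
      have h : x ^ 3 * (3 * x ^ 5 * y + w ^ 3 * t) = 0 := by
        linear_combination e1 - 6 * y * hE5 + (-3 * x ^ 8 * y) * h5
      exact (mul_eq_zero.mp h).resolve_left (pow_ne_zero 3 hx)
    have hE8' : 2 * x * y + w ^ 3 * t = 0 := by
      linear_combination hE8 - 3 * x * y * (x ^ 2 + 3) * hE7 + (-5 * x * y) * h5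
    -- S10: `E9 : t² = 1`
    have hE9 : t ^ 2 - 1 = 0 := by
      have h : -3 * x * y * (t ^ 2 - 1) = 0 := by
        linear_combination hA - 4 * t ^ 2 * hE8' - x * y * hE7 + t ^ 2 * x * y * h5
      have hxy : -3 * x * y ≠ 0 := by
        refine mul_ne_zero (mul_ne_zero ?_ hx) hy
        intro h3
        have : (1 : R) = 0 := by linear_combination -h23 - 2 * h3
        exact one_ne_zero this
      exact (mul_eq_zero.mp h).resolve_left hxy
    -- S11: `E10 : w = 3`, `E11 : y² = x`
    have hE10 : w - 3 = 0 := by linear_combination -3 * hD + 3 * (t ^ 2 + 1) * hE9 - w * h5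
    have hE11 : y ^ 2 - x = 0 := by linear_combination 2 * hE6 - 8 * x * hE7 + (-5 * x - y ^ 2) * h5
    -- S12: `E12 : 3x + 4 = 0`
    have hE12 : 3 * x + 4 = 0 := by
      linear_combination hE1 - (x ^ 6 + 2 * x ^ 4 + 2 * x ^ 3 * y ^ 2 + x ^ 2 + x * y ^ 2 + y ^ 4) * hE11
        - (2 * w ^ 6 + w ^ 5 - 2 * w ^ 4 - w ^ 3 + 2 * w ^ 2 + w - 2) * hE10 - (x ^ 5 + x) * hE7
        + (-w ^ 6 - w ^ 5 + w ^ 4 + w ^ 3 - w ^ 2 - w - x ^ 5 + 2) * h5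
    -- S13: contradiction
    have : (1 : R) = 0 := by linear_combination (3 * x - 4) * hE12 - 9 * hE7 - 2 * h5
    exact one_ne_zero this

/-- **THE OFF-AXIS CLAUSE `hoff` FOR `g = z² + t⁴w⁶ + (y² + x³)³ + t·x³y·w³ + x¹¹ + w⁷` AT `p = 5`** (RGDD-L row F008, diagonalised form):
at every maximal ideal `Q` of `k[X]/(g)` missing some `x̄ⱼ`, `j ∈ {0,1,2,3}`, the local ring satisfies the Cohen–Macaulay + Frobenius-closed
clause — `V(g)` is regular off the `t`-axis (Jacobian: some partial is a unit at `Q`, by `eq_zero_of_jacobian` in the residue domain, then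
`ClauseOfPderivNotMem`). Exact binder shape = the engine's `hoff` for `n = 5`, `J = {0,1,2,3}`, `p = 5`.
[cite: Matsumura1987, Thm. 30.4 (ii)] -/
theorem g_offL_clause_char5 (k : Type) [Field k] [CharP k 5] (g : MvPolynomial (Fin 5) k)
    (hg : g = X 2 ^ 2 + X 4 ^ 4 * X 3 ^ 6 + (X 1 ^ 2 + X 0 ^ 3) ^ 3 + X 4 * X 0 ^ 3 * X 1 * X 3 ^ 3 + X 0 ^ 11 + X 3 ^ 7) :
    ∀ (Q : Ideal (MvPolynomial (Fin 5) k ⧸ Ideal.span {g})) [Q.IsMaximal],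
      (∃ j ∈ ({0, 1, 2, 3} : Finset (Fin 5)), Ideal.Quotient.mk (Ideal.span {g}) (MvPolynomial.X j) ∉ Q) →
      ∀ d : ℕ, ringKrullDim (Localization.AtPrime Q) = d → ∀ s : Fin d → Localization.AtPrime Q,
        (Ideal.span (Set.range s)).radical.IsMaximal →
          RingTheory.Sequence.IsWeaklyRegular (Localization.AtPrime Q) (List.ofFn s) ∧
          ∀ y : Localization.AtPrime Q, (∃ e : ℕ, y ^ 5 ^ e ∈ Ideal.span
            ((fun z : Localization.AtPrime Q => z ^ 5 ^ e) ''
              (Ideal.span (Set.range s) : Set (Localization.AtPrime Q)))) → y ∈ Ideal.span (Set.range s) := by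
  haveI : Fact (Nat.Prime 5) := ⟨by norm_num⟩
  intro Q _ hj d hd s hs
  -- the five partial derivatives
  have hd0 : pderiv 0 g = 9 * X 0 ^ 2 * (X 1 ^ 2 + X 0 ^ 3) ^ 2 + 3 * X 4 * X 0 ^ 2 * X 1 * X 3 ^ 3 + 11 * X 0 ^ 10 := by
    rw [hg]
    simp only [map_add, Derivation.leibniz, pderiv_pow, pderiv_X_self, smul_eq_mul,
      pderiv_X_of_ne (show (1 : Fin 5) ≠ 0 by decide), pderiv_X_of_ne (show (2 : Fin 5) ≠ 0 by decide),
      pderiv_X_of_ne (show (3 : Fin 5) ≠ 0 by decide), pderiv_X_of_ne (show (4 : Fin 5) ≠ 0 by decide)]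
    norm_num
    ring
  have hd1 : pderiv 1 g = 6 * X 1 * (X 1 ^ 2 + X 0 ^ 3) ^ 2 + X 4 * X 0 ^ 3 * X 3 ^ 3 := by
    rw [hg]
    simp only [map_add, Derivation.leibniz, pderiv_pow, pderiv_X_self, smul_eq_mul,
      pderiv_X_of_ne (show (0 : Fin 5) ≠ 1 by decide), pderiv_X_of_ne (show (2 : Fin 5) ≠ 1 by decide),
      pderiv_X_of_ne (show (3 : Fin 5) ≠ 1 by decide), pderiv_X_of_ne (show (4 : Fin 5) ≠ 1 by decide)]
    norm_num
    ring
  have hd2 : pderiv 2 g = 2 * X 2 := by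
    rw [hg]
    simp only [map_add, Derivation.leibniz, pderiv_pow, pderiv_X_self, smul_eq_mul,
      pderiv_X_of_ne (show (0 : Fin 5) ≠ 2 by decide), pderiv_X_of_ne (show (1 : Fin 5) ≠ 2 by decide),
      pderiv_X_of_ne (show (3 : Fin 5) ≠ 2 by decide), pderiv_X_of_ne (show (4 : Fin 5) ≠ 2 by decide)]
    norm_num
  have hd3 : pderiv 3 g = 6 * X 4 ^ 4 * X 3 ^ 5 + 3 * X 4 * X 0 ^ 3 * X 1 * X 3 ^ 2 + 7 * X 3 ^ 6 := by
    rw [hg]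
    simp only [map_add, Derivation.leibniz, pderiv_pow, pderiv_X_self, smul_eq_mul,
      pderiv_X_of_ne (show (0 : Fin 5) ≠ 3 by decide), pderiv_X_of_ne (show (1 : Fin 5) ≠ 3 by decide),
      pderiv_X_of_ne (show (2 : Fin 5) ≠ 3 by decide), pderiv_X_of_ne (show (4 : Fin 5) ≠ 3 by decide)]
    norm_num
    ring
  have hd4 : pderiv 4 g = 4 * X 4 ^ 3 * X 3 ^ 6 + X 0 ^ 3 * X 1 * X 3 ^ 3 := by
    rw [hg]
    simp only [map_add, Derivation.leibniz, pderiv_pow, pderiv_X_self, smul_eq_mul,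
      pderiv_X_of_ne (show (0 : Fin 5) ≠ 4 by decide), pderiv_X_of_ne (show (1 : Fin 5) ≠ 4 by decide),
      pderiv_X_of_ne (show (2 : Fin 5) ≠ 4 by decide), pderiv_X_of_ne (show (3 : Fin 5) ≠ 4 by decide)]
    norm_num
    ring
  -- Jacobian exits: some partial is not in `P = Q ∩ k[X]`
  by_cases m0 : pderiv 0 g ∈ Q.comap (Ideal.Quotient.mk (Ideal.span {g})); swap
  · exact ClauseOfPderivNotMem.stub_clauseOfPderivNotMem 5 k 5 g Q 0 m0 d hd s hs
  by_cases m1 : pderiv 1 g ∈ Q.comap (Ideal.Quotient.mk (Ideal.span {g})); swap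
  · exact ClauseOfPderivNotMem.stub_clauseOfPderivNotMem 5 k 5 g Q 1 m1 d hd s hs
  by_cases m2 : pderiv 2 g ∈ Q.comap (Ideal.Quotient.mk (Ideal.span {g})); swap
  · exact ClauseOfPderivNotMem.stub_clauseOfPderivNotMem 5 k 5 g Q 2 m2 d hd s hs
  by_cases m3 : pderiv 3 g ∈ Q.comap (Ideal.Quotient.mk (Ideal.span {g})); swap
  · exact ClauseOfPderivNotMem.stub_clauseOfPderivNotMem 5 k 5 g Q 3 m3 d hd s hs
  by_cases m4 : pderiv 4 g ∈ Q.comap (Ideal.Quotient.mk (Ideal.span {g})); swap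
  · exact ClauseOfPderivNotMem.stub_clauseOfPderivNotMem 5 k 5 g Q 4 m4 d hd s hs
  -- all partials in `P`: impossible off `L`, by the residue-domain chain
  exfalso
  haveI hPmax : (Q.comap (Ideal.Quotient.mk (Ideal.span {g}))).IsMaximal :=
    Ideal.comap_isMaximal_of_surjective _ Ideal.Quotient.mk_surjective
  have hgP : g ∈ Q.comap (Ideal.Quotient.mk (Ideal.span {g})) := by
    rw [Ideal.mem_comap, Ideal.Quotient.eq_zero_iff_mem.mpr (Ideal.mem_span_singleton_self g)]
    exact Q.zero_mem
  -- the residue domain `R = k[X] / P` has characteristic `5`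
  haveI : Nontrivial (MvPolynomial (Fin 5) k ⧸ Q.comap (Ideal.Quotient.mk (Ideal.span {g}))) :=
    Ideal.Quotient.nontrivial_iff.mpr hPmax.ne_top
  haveI : CharP (MvPolynomial (Fin 5) k ⧸ Q.comap (Ideal.Quotient.mk (Ideal.span {g}))) 5 :=
    charP_of_injective_algebraMap
      (algebraMap k (MvPolynomial (Fin 5) k ⧸ Q.comap (Ideal.Quotient.mk (Ideal.span {g})))).injective 5
  have h5 : (5 : MvPolynomial (Fin 5) k ⧸ Q.comap (Ideal.Quotient.mk (Ideal.span {g}))) = 0 := by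
    simpa using CharP.cast_eq_zero (MvPolynomial (Fin 5) k ⧸ Q.comap (Ideal.Quotient.mk (Ideal.span {g}))) 5
  set π := Ideal.Quotient.mk (Q.comap (Ideal.Quotient.mk (Ideal.span {g}))) with hπdef
  have hπ : ∀ a : MvPolynomial (Fin 5) k, a ∈ Q.comap (Ideal.Quotient.mk (Ideal.span {g})) → π a = 0 :=
    fun a ha => Ideal.Quotient.eq_zero_iff_mem.mpr ha
  -- the six equations in the residue domain
  have eg : π (X 2 ^ 2 + X 4 ^ 4 * X 3 ^ 6 + (X 1 ^ 2 + X 0 ^ 3) ^ 3 + X 4 * X 0 ^ 3 * X 1 * X 3 ^ 3 + X 0 ^ 11 + X 3 ^ 7) = 0 := by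
    rw [← hg]
    exact hπ g hgP
  have e0 := hπ _ m0
  have e1 := hπ _ m1
  have e2 := hπ _ m2
  have e3 := hπ _ m3
  have e4 := hπ _ m4
  rw [hd0] at e0
  rw [hd1] at e1
  rw [hd2] at e2
  rw [hd3] at e3
  rw [hd4] at e4
  simp only [map_add, map_mul, map_pow, map_ofNat] at eg e0 e1 e2 e3 e4
  obtain ⟨hx, hy, hz, hw⟩ := eq_zero_of_jacobian h5 (π (X 0)) (π (X 1)) (π (X 2)) (π (X 3)) (π (X 4)) eg e0 e1 e2 e3 e4
  -- but some `x̄ⱼ ∉ Q`, `j ≤ 3`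
  obtain ⟨j, hjJ, hjQ⟩ := hj
  apply hjQ
  have key : ∀ i : Fin 5, π (X i) = 0 → Ideal.Quotient.mk (Ideal.span {g}) (X i) ∈ Q := fun i hi =>
    Ideal.mem_comap.mp (Ideal.Quotient.eq_zero_iff_mem.mp hi)
  simp only [Finset.mem_insert, Finset.mem_singleton] at hjJ
  rcases hjJ with rfl | rfl | rfl | rfl
  · exact key 0 hx
  · exact key 1 hy
  · exact key 2 hz
  · exact key 3 hw

end Summit.ResolutionOfSingularities.ResolutionOfSingularities.Theorems.FInjectiveMacaulayfication.RelGddF008Regular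

end
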